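import Summits.QuantumFields.YangMills.Theorems.AlphaInputsT3ACv3AbelianStokes
import Literature.MathematicalPhysics.QuantumFieldTheory.Balaban1983to89.LatticeWordStokes
import HarnessLib

/-!
# `AlphaInputsT3ACv3AbelianSmall` — STRATEGY B for 2′, toward (D6R-CHARGED): THE LOOP SUMS OF A ONE-FORM WITH SMALL CURL ARE SMALL (by scaling, from the tree's crude non-abelian
# Stokes bound), SO THE (0.4)/`exp[mean log]` AVERAGE OF ITS ABELIAN CONFIGURATION IS ABELIAN **UNCONDITIONALLY ON SMALL-CURL FORMS** — lane `pub-balaban3d`, seat alpha-2 (g3)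

WHAT (HOME `D6L-STATUS-alpha2-g3.md` §5 (a); over `…AbelianStokes`, `LatticeWordStokes.dist1_loopHol_le`).  §1 scaling of one-forms (`wsum_smul`, `loopSum_smul`), the plaquette and
loop distances of abelian configurations (`dist1_gexp`, `dist1_plaqHol_gexpAt_le`); §2 ★ `abs_loopSum_le`: if every fine curl is `≤ B` then every (0.4) loop sum is
`≤ (π/2)·(((d+2)L)²/4)·B` — proof: apply the crude Stokes bound `dist1_loopHol_le` to the RESCALED configuration `gexp(s·a)` (`s → 0`) and the lower bound
`|t|‖X‖ ≤ (π/2)‖exp(tX) − 1‖`; the scale `s` cancels; §3 ★★ `blockAvg_gexpAt_of_curl_le`: for `SU(N)` and `(π/2)(((d+2)L)²/4)·B·‖Y‖ < min(δ_N, ln 2)` the guard and the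
principal-log range hold at every coarse bond, so `blockAvg ℰp (gexpAt a) = gexpAt (linAvg04 a)` as configurations.
HONEST FRAMING.  Kernel algebra∕analysis of one-parameter subgroups; nothing of [B10]∕[7]∕[4]'s estimates asserted; count-neutral helper toward R3 2′ (`stub_laneRecordsV3`, items
19935∕19936); nothing about d = 4, the continuum, or a mass gap.

References: T. Bałaban, Commun. Math. Phys. 98 (1985) 17–51 [Balaban1985Averaging] ((19)–(20), (24)–(25) p.21); CMP 109 (1987) 249–301 [Balaban1987RG1] ((0.4) p.253).
-/

set_option autoImplicit false

noncomputable section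

namespace Summit.QuantumFields.YangMills.Theorems.AbelianEML

open scoped BigOperators Matrix.Norms.L2Operator
open NormedSpace
open Literature.MathematicalPhysics.QuantumFieldTheory.Balaban1983to89
open Literature.MathematicalPhysics.QuantumFieldTheory.Balaban1983to89.T4Continuum
open Literature.MathematicalPhysics.QuantumFieldTheory.Balaban1983to89.BlockAveraging (loopHol off Idx blockAvg)
open Literature.MathematicalPhysics.QuantumFieldTheory.Balaban1983to89.LatticeWordStokes (dist1_loopHol_le)
open Literature.MathematicalPhysics.QuantumFieldTheory.Balaban1985CMP102.Setting
open Summit.QuantumFields.Balaban3D.Carriers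
open Summit.QuantumFields.Balaban3D.Proofs.GroupModelSkew (conjTranspose_eq_neg_of_mem_lie)
open Summit.QuantumFields.YangMills.Theorems.BalabanUVNodesN08AlphaAbelianLift (gexp rho_gexp norm_exp_real_smul_sub_one_le abs_mul_norm_le_of_exp)
open ExpMeanLog (expMeanLogSU deltaSU)

variable {P : Params} {j : ℕ} {G : Type} [GaugeGroup G] [MeasurableSpace G] (𝔊 : GroupModel G) {X : Matrix (Fin 𝔊.N) (Fin 𝔊.N) ℂ} (hX : X ∈ 𝔊.lie)

/-! ## §1 Scaling; distances of abelian configurations -/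

/-- Walk sums are linear in the one-form (scaling). [folklore] -/
theorem wsum_smul (s : ℝ) (a : PBond P j → ℝ) : ∀ (w : List (Letter P.d)) (x : Site P j), wsum (fun b => s * a b) x w = s * wsum a x w
  | [], x => by simp
  | (μ, true) :: w, x => by rw [wsum_cons_true, wsum_cons_true, wsum_smul s a w]; ring
  | (μ, false) :: w, x => by rw [wsum_cons_false, wsum_cons_false, wsum_smul s a w]; ring

/-- Loop sums are linear in the one-form (scaling). [folklore] -/
theorem loopSum_smul (s : ℝ) (a : PBond P j → ℝ) (c : PBond P (j + 1)) (i : Idx P) : loopSum (fun b => s * a b) c i = s * loopSum a c i :=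
  wsum_smul s a _ _

/-- Curls are linear in the one-form (scaling). [folklore] -/
theorem curlAt_smul (s : ℝ) (a : PBond P j → ℝ) (x : Site P j) (μ ν : Fin P.d) : curlAt (fun b => s * a b) x μ ν = s * curlAt a x μ ν := by
  simp only [curlAt]; ring

/-- `|gexp t − 1| = ‖exp(tX) − 1‖` (the group as printed has `dist1 = ‖ρ(·) − 1‖`). [cite: Balaban1985Averaging, (19) p.21] -/
theorem dist1_gexp (t : ℝ) : dist1 (gexp 𝔊 hX t) = ‖exp (((t : ℝ) : ℂ) • X) - 1‖ := by
  rw [𝔊.dist1_eq, UnitaryModel.opDist1, rho_gexp]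

/-- The plaquette distance of an abelian configuration is at most `|curl|·‖X‖`. [cite: Balaban1985Averaging, (24) p.21] -/
theorem dist1_plaqHol_gexpAt_le (a : PBond P j → ℝ) (p : Plaq P j) :
    dist1 (GaugeField.plaqHol (gexpAt 𝔊 hX a) p) ≤ |curlAt a p.src p.μ p.ν| * ‖X‖ := by
  rw [plaqHol_gexpAt, dist1_gexp]
  exact norm_exp_real_smul_sub_one_le (conjTranspose_eq_neg_of_mem_lie 𝔊 hX) _

/-- The loop-variable distance of an abelian configuration is at most `|loopSum|·‖X‖`. [cite: Balaban1985Averaging, (24) p.21] -/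
theorem dist1_loopHol_gexpAt_le (a : PBond P j → ℝ) (c : PBond P (j + 1)) (i : Idx P) :
    dist1 (loopHol (gexpAt 𝔊 hX a) c i) ≤ |loopSum a c i| * ‖X‖ := by
  rw [loopHol_gexpAt, dist1_gexp]
  exact norm_exp_real_smul_sub_one_le (conjTranspose_eq_neg_of_mem_lie 𝔊 hX) _

/-! ## §2 Loop sums of small-curl one-forms are small (scaling trick) -/

/-- **★ THE (0.4) LOOP SUMS OF A ONE-FORM WITH CURL `≤ B` ARE AT MOST `(π/2)·(((d+2)L)²/4)·B`.**  (Needs one nonzero direction `X ∈ 𝔤` of some group as printed to run the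
tree's non-abelian Stokes bound on the rescaled abelian configuration; the scale cancels.) [cite: Balaban1985Averaging, (19)–(20) p.21; Balaban1987RG1, (0.4) p.253] -/
theorem abs_loopSum_le (hX : X ∈ 𝔊.lie) (hX0 : X ≠ 0) (a : PBond P j → ℝ) {B : ℝ} (hB0 : 0 ≤ B) (hB : ∀ p : Plaq P j, |curlAt a p.src p.μ p.ν| ≤ B)
    (c : PBond P (j + 1)) (i : Idx P) :
    |loopSum a c i| ≤ Real.pi / 2 * (((((P.d + 2) * P.L : ℕ) : ℝ) ^ 2 / 4) * B) := by
  set t := loopSum a c i with ht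
  set K : ℝ := ((((P.d + 2) * P.L : ℕ) : ℝ) ^ 2 / 4) with hK
  have hK0 : 0 ≤ K := by positivity
  have hnX : 0 < ‖X‖ := norm_pos_iff.mpr hX0
  have hpi := Real.pi_pos
  -- the scale
  set s : ℝ := Real.pi / (|t| * ‖X‖ + Real.pi) with hs
  have hden : 0 < |t| * ‖X‖ + Real.pi := by positivity
  have hs0 : 0 < s := div_pos hpi hden
  have hstπ : s * (|t| * ‖X‖) ≤ Real.pi := by
    rw [hs, div_mul_eq_mul_div, div_le_iff₀ hden]; nlinarith [abs_nonneg t]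
  have hskew := conjTranspose_eq_neg_of_mem_lie 𝔊 hX
  -- for every slack `η > 0`: `(2/π)·s|t|‖X‖ ≤ K (s B ‖X‖ + η)`
  have hmain : ∀ η : ℝ, 0 < η → s * (|t| * ‖X‖) ≤ Real.pi / 2 * (K * (s * B * ‖X‖ + η)) := by
    intro η hη
    have hsmall : PlaqSmall (s * B * ‖X‖ + η) (gexpAt 𝔊 hX fun b => s * a b) := by
      intro p
      refine (dist1_plaqHol_gexpAt_le 𝔊 hX _ p).trans_lt ?_
      rw [curlAt_smul, abs_mul, abs_of_pos hs0]
      have h1 : s * |curlAt a p.src p.μ p.ν| * ‖X‖ ≤ s * B * ‖X‖ :=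
        mul_le_mul_of_nonneg_right (mul_le_mul_of_nonneg_left (hB p) hs0.le) (norm_nonneg _)
      linarith
    have hδ0 : 0 ≤ s * B * ‖X‖ + η := by positivity
    have h1 := dist1_loopHol_le hδ0 hsmall c i
    rw [loopHol_gexpAt, loopSum_smul, dist1_gexp] at h1
    have hupper : |s * t| * ‖X‖ ≤ Real.pi := by rw [abs_mul, abs_of_pos hs0, mul_assoc]; exact hstπ
    have hlow := abs_mul_norm_le_of_exp hskew hupper
    rw [abs_mul, abs_of_pos hs0, mul_assoc] at hlow
    exact hlow.trans (mul_le_mul_of_nonneg_left h1 (by positivity))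
  -- let `η → 0`
  have hlim : s * (|t| * ‖X‖) ≤ Real.pi / 2 * (K * (s * B * ‖X‖)) := by
    refine le_of_forall_pos_le_add fun ε hε => ?_
    have hη : 0 < ε / (Real.pi / 2 * K + 1) := div_pos hε (by positivity)
    refine (hmain _ hη).trans ?_
    have : Real.pi / 2 * (K * (ε / (Real.pi / 2 * K + 1))) ≤ ε := by
      rw [← mul_assoc, mul_div_assoc', div_le_iff₀ (by positivity)]; nlinarith
    nlinarith
  -- cancel `s‖X‖ > 0`
  have hsX : 0 < s * ‖X‖ := mul_pos hs0 hnX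
  have : s * ‖X‖ * |t| ≤ s * ‖X‖ * (Real.pi / 2 * (K * B)) := by nlinarith
  exact le_of_mul_le_mul_left this hsX

/-! ## §3 The (0.4)/`exp[mean log]` average of a small-curl abelian configuration is abelian, unconditionally -/

section SUN

open BlockAveraging (blockAvg)

variable {N : ℕ} [NeZero N] {Y : Matrix (Fin N) (Fin N) ℂ} (hY : Y ∈ (suGroupModel N).lie)

/-- **★★ ON SMALL-CURL ONE-FORMS THE (0.4) BLOCK AVERAGE OF THE ABELIAN CONFIGURATION IS THE ABELIAN CONFIGURATION OF THE LINEARLY AVERAGED FORM**: if every fine curl is `≤ B` and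
`(π/2)(((d+2)L)²/4)·B·‖Y‖ < min(δ_N, ln 2)`, then `blockAvg ℰp (gexpAt a) = gexpAt (linAvg04 a)`. [cite: Balaban1987RG1, (0.4) p.253] -/
theorem blockAvg_gexpAt_of_curl_le (hY0 : Y ≠ 0) (a : PBond P j → ℝ) {B : ℝ} (hB0 : 0 ≤ B) (hB : ∀ p : Plaq P j, |curlAt a p.src p.μ p.ν| ≤ B)
    (hsmall : Real.pi / 2 * (((((P.d + 2) * P.L : ℕ) : ℝ) ^ 2 / 4) * B) * ‖Y‖ < min (deltaSU (Fin N)) (Real.log 2)) :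
    (blockAvg (P := P) (j := j) (expMeanLogSU (n := Fin N))).avg (gexpAt (suGroupModel N) hY a) = gexpAt (suGroupModel N) hY (linAvg04 a) := by
  funext c
  have hloop : ∀ i, |loopSum a c i| * ‖Y‖ < min (deltaSU (Fin N)) (Real.log 2) := fun i =>
    (mul_le_mul_of_nonneg_right (abs_loopSum_le (suGroupModel N) hY hY0 a hB0 hB c i) (norm_nonneg _)).trans_lt hsmall
  refine blockAvg_gexpAt_apply hY a c (fun i => ?_) (fun i => (hloop i).trans_le (min_le_right _ _))
  exact (dist1_loopHol_gexpAt_le (suGroupModel N) hY a c i).trans_lt ((hloop i).trans_le (min_le_left _ _))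

end SUN

/-! ## §4 Iteration from the finest level: the `s`-fold average of a small-curl abelian configuration -/

/-- **THE ITERATED (0.4) LINEAR AVERAGE** from level `0` to level `s`. [cite: Balaban1987RG1, (0.11) p.253] -/
def linAvgIter : (s : ℕ) → (PBond P 0 → ℝ) → (PBond P s → ℝ)
  | 0 => id
  | s + 1 => fun a => linAvg04 (linAvgIter s a)

/-- `linAvgIter (s+1) a = linAvg04 (linAvgIter s a)`. [folklore] -/
theorem linAvgIter_succ (s : ℕ) (a : PBond P 0 → ℝ) : linAvgIter (s + 1) a = linAvg04 (linAvgIter s a) := rfl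

/-- **The curls of the iterated linear averages grow at most by `L²` per level**: `|curl (linAvgIter s a)| ≤ (L²)^s·B`. [cite: Balaban1985Averaging, (14) p.19] -/
theorem abs_curlAt_linAvgIter_le (a : PBond P 0 → ℝ) {B : ℝ} (hB : ∀ p : Plaq P 0, |curlAt a p.src p.μ p.ν| ≤ B)
    (hBall : ∀ (x : Site P 0) (μ ν : Fin P.d), |curlAt a x μ ν| ≤ B) :
    ∀ (s : ℕ) (x : Site P s) (μ ν : Fin P.d), |curlAt (linAvgIter s a) x μ ν| ≤ ((P.L : ℝ) ^ 2) ^ s * B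
  | 0, x, μ, ν => by simpa [linAvgIter] using hBall x μ ν
  | s + 1, y, μ, ν => by
    rw [linAvgIter_succ, pow_succ, mul_comm (((P.L : ℝ) ^ 2) ^ s), mul_assoc]
    exact abs_curl_linAvg04_le (linAvgIter s a) y μ ν fun r s' t _ _ => abs_curlAt_linAvgIter_le a hB hBall s _ μ ν

section SUNIter

open BlockAveraging (blockAvg)

variable {N : ℕ} [NeZero N] {Y : Matrix (Fin N) (Fin N) ℂ} (hY : Y ∈ (suGroupModel N).lie)

/-- **★★ THE `s`-FOLD (0.4)/`exp[mean log]` AVERAGE OF A SMALL-CURL ABELIAN CONFIGURATION IS THE ABELIAN CONFIGURATION OF THE `s`-FOLD LINEAR AVERAGE**: if every curl of `a` (at every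
position and pair of directions of the finest lattice) is `≤ B` and `(π/2)(((d+2)L)²/4)·(L²)^s·B·‖Y‖ < min(δ_N, ln 2)`, then `M^s(gexpAt a) = gexpAt (linAvgIter s a)`.
[cite: Balaban1987RG1, (0.4)+(0.11) p.253] -/
theorem iter_blockAvg_gexpAt (hY0 : Y ≠ 0) (a : PBond P 0 → ℝ) {B : ℝ} (hB0 : 0 ≤ B) (hBall : ∀ (x : Site P 0) (μ ν : Fin P.d), |curlAt a x μ ν| ≤ B) :
    ∀ s : ℕ, Real.pi / 2 * (((((P.d + 2) * P.L : ℕ) : ℝ) ^ 2 / 4) * (((P.L : ℝ) ^ 2) ^ s * B)) * ‖Y‖ < min (deltaSU (Fin N)) (Real.log 2) →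
      Averaging.iter (fun i => blockAvg (P := P) (j := i) (expMeanLogSU (n := Fin N))) s (gexpAt (suGroupModel N) hY a) =
        gexpAt (suGroupModel N) hY (linAvgIter s a)
  | 0, _ => rfl
  | s + 1, hs => by
    have hL1 : (1 : ℝ) ≤ (P.L : ℝ) ^ 2 := one_le_pow₀ (by exact_mod_cast P.L_pos)
    have hK0 : (0 : ℝ) ≤ Real.pi / 2 * ((((P.d + 2) * P.L : ℕ) : ℝ) ^ 2 / 4) := by positivity
    -- the threshold at level `s` follows from the one at level `s+1`
    have hs' : Real.pi / 2 * (((((P.d + 2) * P.L : ℕ) : ℝ) ^ 2 / 4) * (((P.L : ℝ) ^ 2) ^ s * B)) * ‖Y‖ < min (deltaSU (Fin N)) (Real.log 2) := by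
      refine lt_of_le_of_lt ?_ hs
      have hmono : ((P.L : ℝ) ^ 2) ^ s * B ≤ ((P.L : ℝ) ^ 2) ^ (s + 1) * B :=
        mul_le_mul_of_nonneg_right (pow_le_pow_right₀ hL1 (Nat.le_succ s)) hB0
      have := mul_le_mul_of_nonneg_left hmono hK0
      exact mul_le_mul_of_nonneg_right (by nlinarith) (norm_nonneg _)
    have ih := iter_blockAvg_gexpAt hY0 a hB0 hBall s hs'
    show (blockAvg (P := P) (j := s) (expMeanLogSU (n := Fin N))).avg (Averaging.iter _ s _) = _
    rw [ih, linAvgIter_succ]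
    have hBp : ∀ p : Plaq P 0, |curlAt a p.src p.μ p.ν| ≤ B := fun p => hBall _ _ _
    refine blockAvg_gexpAt_of_curl_le hY hY0 (linAvgIter s a) (B := ((P.L : ℝ) ^ 2) ^ s * B) (by positivity)
      (fun p => abs_curlAt_linAvgIter_le a hBp hBall s _ _ _) ?_
    exact hs'

end SUNIter

end Summit.QuantumFields.YangMills.Theorems.AbelianEML

end
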